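import Literature.IUT.HodgeTheaters.PiAvatarBinding
import HarnessLib

/-!
# Glue: abc-iut-L5-t2's base-changed groups `Π_{(−)_v̲} = Π_{(−)} ×_{G_F} Γ` pushed into `Π_{C_F}` ARE the embedded
# local objects of the Π-avatar binding (proof-only)

S. Mochizuki, *Inter-universal Teichmüller theory I*, kurims manuscript (May 2020), Def 3.1 (e) pp. 62–63 ("for each
`v̲ ∈ V(K)` … the result of base-changing … natural cartesian diagrams `X̲_v̲ → X_v̲ → X_v` … `Δ_X → Π_{X̲_v̲} → Π_{X_v}`
… injections of profinite groups") ([IUTchI] Def 3.1 (e) p.62) [claim: Mochizuki2012, status: disputed] (D-0012 claim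
key, series status DISPUTED — subgroup bookkeeping over abc-iut-L5-t2's REAL `InitialThetaData`; nothing of the series is
asserted, no side is taken on [IUTchIII] Cor. 3.12).

abc-iut-L5-t2 types the base change `Π_{(−)_v̲}` as the fibre product `D.PiLoc H ρ ⊆ Π_{C_F} × Γ` with first projection
`D.fstLoc H ρ` (`InitialThetaDataLocalGroups`, p418716; `range_fstLoc : range = H ∩ augGF⁻¹(ρ(Γ))`) and builds the local
§1 datum `D.peLoc` inside `D.PiLoc D.PiCK ρ` with `peLoc_PiX = Π_{X_F}.comap fstLoc`, `peLoc_PiCbar = Π_{C̲_K}.comap fstLoc`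
(p421799).  abc-iut-L5-t4's binding (`PiAvatarBinding`, p423760; design D1 EMBEDDED) uses instead SUBGROUPS OF `Π_{C_F}`:
`Π_{(−)} ∩ augGF⁻¹(G_v̲)`.  This file records that the two agree: pushing a `comap fstLoc`-subgroup forward along `fstLoc`
gives the embedded subgroup (`map_fstLoc_comap_of_le`), in particular for `Π_{C̲_K}` and `Π_{X̲_K}`
(`map_fstLoc_comap_PiCund`, `map_fstLoc_PiX_inf_PiCund`), with `PiXund_eq_PiX_inf_PiCund : Π_{X̲_K} = Π_{X_F} ∩ Π_{C̲_K}`.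

Proof-only; typed ≠ proved elsewhere.
-/

noncomputable section

namespace Literature.IUT.HodgeTheaters

universe u v w w'

section Local

variable {F : Type u} {K : Type v} {Fbar : Type w} [Field F] [NumberField F] [Field K] [NumberField K]
  [Algebra F K] [Field Fbar] [Algebra F Fbar] [Algebra K Fbar]
  {E : WeierstrassCurve F} [E.IsElliptic] {l : ℕ} {Pb : BadPlacePredicates K}
  (D : InitialThetaData F K Fbar E l Pb) (H : Subgroup D.PiC)
  {Γ : Type w'} [Group Γ] (ρ : Γ →* (Fbar ≃ₐ[F] Fbar))

namespace InitialThetaData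

/-- Pushing the preimage of `S ≤ Π_{C_F}` in `Π_{(−)_v̲} = H ×_{G_F} Γ` forward along the first projection gives
`S ∩ H ∩ augGF⁻¹(ρ(Γ))` (Def 3.1 (e): the base change, read as a subgroup of `Π_{C_F}`).
([IUTchI] Def 3.1 (e) p.62) [claim: Mochizuki2012, status: disputed] -/
theorem map_fstLoc_comap (S : Subgroup D.PiC) :
    (S.comap (D.fstLoc H ρ)).map (D.fstLoc H ρ) = S ⊓ (H ⊓ ρ.range.comap D.augGF) := by
  rw [Subgroup.map_comap_eq, D.range_fstLoc, inf_comm]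

/-- For `S ≤ H`: the push-forward of `S.comap fstLoc` is `S ∩ augGF⁻¹(ρ(Γ))` — the EMBEDDED local object of `S` used by
abc-iut-L5-t4's binding (`locModelObj`-shape). ([IUTchI] Def 3.1 (e) p.62) [claim: Mochizuki2012, status: disputed] -/
theorem map_fstLoc_comap_of_le {S : Subgroup D.PiC} (hS : S ≤ H) :
    (S.comap (D.fstLoc H ρ)).map (D.fstLoc H ρ) = S ⊓ ρ.range.comap D.augGF := by
  rw [D.map_fstLoc_comap H ρ S, ← inf_assoc, inf_eq_left.mpr hS]

/-- `Π_{C̲_K} ≤ Π_{C_K}` inside `Π_{C_F}` (the K-core). ([IUTchI] Def 3.1 (d) p.62) [claim: Mochizuki2012, status: disputed] -/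
theorem PiCund_le_PiCK : D.PiCund ≤ D.PiCK := Subgroup.map_le_range _ _

/-- **`Π_{X̲_K} = Π_{X_F} ∩ Π_{C̲_K}`** inside `Π_{C_F}` (Def 3.1 (d): `X̲_K → X_K`, `X̲_K → C̲_K`; t1's `PiXbar = PiX ⊓ PiCbar`
pushed along the injective `embK`, using `ThetaGeometry.embK_PiX`). ([IUTchI] Def 3.1 (d) p.62) [claim: Mochizuki2012, status: disputed] -/
theorem PiXund_eq_PiX_inf_PiCund : D.PiXund = D.geom.PiX ⊓ D.PiCund := by
  rw [InitialThetaData.PiXund, PuncturedEllipticData.PiXbar,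
    Subgroup.map_inf_eq _ _ _ D.geom.embK_injective, D.geom.embK_PiX, InitialThetaData.PiCund, inf_assoc,
    inf_eq_right.mpr (Subgroup.map_le_range _ _ : D.geom.pe.PiCbar.map D.geom.embK ≤ D.geom.embK.range)]

/-- **The local `𝒟^⊚`-group**: abc-iut-L5-t2's `Π_{C̲_v̲} = (peLoc).PiCbar = Π_{C̲_K}.comap fstLoc` (over `H = Π_{C_K}`) pushed
into `Π_{C_F}` is the embedded subgroup `Π_{C̲_K} ∩ augGF⁻¹(ρ(Γ))`. ([IUTchI] Def 3.1 (e) p.62) [claim: Mochizuki2012, status: disputed] -/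
theorem map_fstLoc_comap_PiCund :
    (D.PiCund.comap (D.fstLoc D.PiCK ρ)).map (D.fstLoc D.PiCK ρ) = D.PiCund ⊓ ρ.range.comap D.augGF :=
  D.map_fstLoc_comap_of_le D.PiCK ρ D.PiCund_le_PiCK

/-- **The local `𝒟^{⊚±}`-group**: abc-iut-L5-t2's `Π_{X̲_v̲} = (peLoc).PiXbar = Π_{X_F}.comap fstLoc ⊓ Π_{C̲_K}.comap fstLoc`
pushed into `Π_{C_F}` is the embedded subgroup `Π_{X̲_K} ∩ augGF⁻¹(ρ(Γ))`. ([IUTchI] Def 3.1 (e) p.62) [claim: Mochizuki2012, status: disputed] -/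
theorem map_fstLoc_PiX_inf_PiCund :
    (D.geom.PiX.comap (D.fstLoc D.PiCK ρ) ⊓ D.PiCund.comap (D.fstLoc D.PiCK ρ)).map (D.fstLoc D.PiCK ρ) =
      D.PiXund ⊓ ρ.range.comap D.augGF := by
  rw [← Subgroup.comap_inf, D.PiXund_eq_PiX_inf_PiCund]
  exact D.map_fstLoc_comap_of_le D.PiCK ρ (inf_le_right.trans D.PiCund_le_PiCK)

end InitialThetaData

end Local

end Literature.IUT.HodgeTheaters
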